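import Summits.QuantumFields.BalabanUV.T4Continuum.Support.NE7PairCubeChart
import Summits.QuantumFields.BalabanUV.T4Continuum.Support.NE7PairChartCorners
import Summits.QuantumFields.BalabanUV.T4Continuum.Support.NE7SliceInduction
import HarnessLib

/-!
# NE7PairChartData — THE CHART DATA OF A PAIR WITH EQUAL TOP AVERAGES (F323a, d = 4, L = 2): for unitary `(N·M)`-periodic `U′`, `U_s` (`M = 2^{k+1}`) with
# plaquettes `η`-close to `1`, the SAME `(k+1)`-fold average, and `10¹² · card n · M²η ≤ 1`: a pinned `N`-equivariant pair-chart family on the radius-`M` cubes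
# with cube letter `η_ch = 262144·Mη` and site-closeness `τ_cc = 4358144·M²η`

Cell `pub-balaban`, sub-cell t4, lineage `b2b-balaban-t4-ne7-p1` (CRUX PROVER NE7 #1 = OWNER of row NE7), gen 94; memo
`t4/b2b-balaban-t4-ne7-p1-g94/PAIR-REP-ROAD.md` §8.  File 9 of the road to the PAIR RESIDUAL SUP-REPRESENTATIVE: the regime arithmetic of gen 93's cube chart at
radius `M` (F317), the corner-segment datum `S ≤ 20480·M²η` from the tree's iterated-average-vs-segment letter (`NE7IteratedAverageSegment.norm_cavgIter_sub_seg_le_top`,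
closed form `NE7SliceInduction.segSum_le`) applied to BOTH configurations — this is where the EQUALITY OF THE TOP AVERAGES enters —, and F318's corner consistency and
site-closeness.
WHAT ([folklore]; 0 def, 0 sorry): `chart_regime` (arithmetic), `corner_segment_datum`, `exists_pair_chart_data` (the bundle consumed by the gluing induction F321).
HONEST FRAMING: composition; nothing of Bałaban's asserted; hleaves NOT discharged; NE7 NOT PROVED; spine 0∕9; finite T⁴ rung (B)+1 — NOT infinite volume, NOT mass gap,
NOT `BetaPertH`, NOT Clay.  Axioms ⊆ {propext, Classical.choice, Quot.sound}.
-/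

set_option autoImplicit false

open scoped BigOperators Matrix Matrix.Norms.L2Operator
open Finset NormedSpace

namespace Summit.QuantumFields.BalabanUV.T4Continuum.NE7PairChartData

open Literature.MathematicalPhysics.QuantumFieldTheory.Balaban1983to89
open B7Prop1Explicit B7Prop2Explicit
open T4AveragingDeficitWall (IsUnitaryCfg SmallField)
open T4AveragingDeficitWallBoundary (IsPeriodicCfg)
open AveragingDeficitTwoLevelPrep (twoLevelSmall)
open AveragingDeficitMultiLevelPrep (cavgIter LevelSmall radIter)
open SpreadLift (loopRad)
open NE3ClassRadiusFamily (levelSmall_of_small)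
open NE7IteratedAverageSegment (norm_cavgIter_sub_seg_le_top)
open NE7SliceInduction (segSum_le)
open NE7PairCubeChart (exists_pair_chart_family)
open NE7PairChartCorners (norm_chart_sub_chart_le)

noncomputable section

variable {n : Type} [Fintype n] [DecidableEq n] [Nonempty n]

/-! ## §1 The regime arithmetic at radius `M` -/

omit [Fintype n] [DecidableEq n] [Nonempty n] in
/-- **THE REGIME OF THE CUBE CHART AT RADIUS `M`** from the single line `10¹²·c·M²η ≤ 1` (`c ≥ 1`, `M ≥ 2`, `η > 0`): the three regime letters of
`cube_landau_chart` with `ε′ = 2η`, and the cube letter `4·128·4³·(2M+3)·2η ≤ 262144·Mη`. [folklore] -/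
theorem chart_regime {M : ℕ} (hM : 2 ≤ M) {η c : ℝ} (hη : 0 < η) (hc : 1 ≤ c) (hθ : 1000000000000 * c * ((M : ℝ) ^ 2 * η) ≤ 1) :
    η + 8 * (Real.pi / 2 * (3 * ((2 * M + 2 : ℕ) : ℝ) * η)) * (Real.exp (4 * (Real.pi / 2 * (3 * ((2 * M + 2 : ℕ) : ℝ) * η))) - 1) ≤ 2 * η ∧
    576 * (64 * ((4 : ℕ) : ℝ) ^ 3 * ((2 * M + 2 + 1 : ℕ) : ℝ)) ^ 2 * (2 * η) ≤ 1 ∧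
    c * (1 + 2 * ((4 : ℕ) : ℝ) * ((2 * M + 2 + 1 : ℕ) : ℝ)) * (256 * ((4 : ℕ) : ℝ) ^ 3 * ((2 * M + 2 + 1 : ℕ) : ℝ) * (2 * η)) ≤ 1 / 2 ∧
    4 * (128 * ((4 : ℕ) : ℝ) ^ 3 * ((2 * M + 2 + 1 : ℕ) : ℝ) * (2 * η)) ≤ 262144 * (M : ℝ) * η := by
  have hM2 : (2 : ℝ) ≤ M := by exact_mod_cast hM
  have hθ1 : (M : ℝ) ^ 2 * η ≤ 1 / 1000000000000 := by
    have h1 : (M : ℝ) ^ 2 * η ≤ c * ((M : ℝ) ^ 2 * η) := le_mul_of_one_le_left (by positivity) hc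
    nlinarith
  have hX : ((2 * M + 2 + 1 : ℕ) : ℝ) ≤ 4 * M := by push_cast; linarith
  have hX1 : (1 : ℝ) ≤ ((2 * M + 2 + 1 : ℕ) : ℝ) := by push_cast; linarith
  have hX₂ : ((2 * M + 2 : ℕ) : ℝ) ≤ 3 * M := by push_cast; linarith
  have hMη : (M : ℝ) * η ≤ (M : ℝ) ^ 2 * η := mul_le_mul_of_nonneg_right (by nlinarith) hη.le
  -- the logarithm letter `b₀ ≤ 15 Mη`, `4b₀ ≤ 1`
  set b₀ : ℝ := Real.pi / 2 * (3 * ((2 * M + 2 : ℕ) : ℝ) * η) with hb₀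
  have hb₀0 : 0 ≤ b₀ := by positivity
  have hb₀le : b₀ ≤ 15 * ((M : ℝ) * η) := by
    rw [hb₀]
    have h1 : Real.pi / 2 ≤ 5 / 3 := by linarith [Real.pi_lt_d2]
    calc Real.pi / 2 * (3 * ((2 * M + 2 : ℕ) : ℝ) * η) ≤ 5 / 3 * (3 * ((2 * M + 2 : ℕ) : ℝ) * η) :=
          mul_le_mul_of_nonneg_right h1 (by positivity)
      _ = 5 * (((2 * M + 2 : ℕ) : ℝ) * η) := by ring
      _ ≤ 5 * (3 * M * η) := by gcongr
      _ = 15 * ((M : ℝ) * η) := by ring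
  have h4b₀ : 4 * b₀ ≤ 1 := by nlinarith
  have hexp : Real.exp (4 * b₀) - 1 ≤ 8 * b₀ := by
    have h := Real.abs_exp_sub_one_le (x := 4 * b₀) (by rw [abs_of_nonneg (by positivity)]; exact h4b₀)
    rw [abs_of_nonneg (by positivity : (0 : ℝ) ≤ 4 * b₀)] at h
    linarith [le_abs_self (Real.exp (4 * b₀) - 1)]
  refine ⟨?_, ?_, ?_, ?_⟩
  · -- `8b₀(e^{4b₀} − 1) ≤ 64 b₀² ≤ 64·225·(Mη)² ≤ η`
    have h1 : 8 * b₀ * (Real.exp (4 * b₀) - 1) ≤ 64 * (b₀ * b₀) := by nlinarith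
    have h2 : b₀ * b₀ ≤ 225 * ((M : ℝ) ^ 2 * η) * η := by
      have := mul_le_mul hb₀le hb₀le hb₀0 (by positivity)
      nlinarith
    have h3 : 64 * (225 * ((M : ℝ) ^ 2 * η) * η) ≤ η := by
      have : 64 * (225 * ((M : ℝ) ^ 2 * η)) ≤ 1 := by nlinarith
      nlinarith
    show η + 8 * b₀ * (Real.exp (4 * b₀) - 1) ≤ 2 * η
    linarith
  · calc 576 * (64 * ((4 : ℕ) : ℝ) ^ 3 * ((2 * M + 2 + 1 : ℕ) : ℝ)) ^ 2 * (2 * η)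
        ≤ 576 * (64 * ((4 : ℕ) : ℝ) ^ 3 * (4 * M)) ^ 2 * (2 * η) := by gcongr
      _ = 309237645312 * ((M : ℝ) ^ 2 * η) := by push_cast; ring
      _ ≤ 1 := by nlinarith
  · have h9 : (1 + 2 * ((4 : ℕ) : ℝ) * ((2 * M + 2 + 1 : ℕ) : ℝ)) ≤ 9 * ((2 * M + 2 + 1 : ℕ) : ℝ) := by push_cast; linarith
    calc c * (1 + 2 * ((4 : ℕ) : ℝ) * ((2 * M + 2 + 1 : ℕ) : ℝ)) * (256 * ((4 : ℕ) : ℝ) ^ 3 * ((2 * M + 2 + 1 : ℕ) : ℝ) * (2 * η))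
        ≤ c * (9 * (4 * M)) * (256 * ((4 : ℕ) : ℝ) ^ 3 * (4 * M) * (2 * η)) := by gcongr; exact h9.trans (by linarith)
      _ = 4718592 * (c * ((M : ℝ) ^ 2 * η)) := by push_cast; ring
      _ ≤ 1 / 2 := by nlinarith
  · calc 4 * (128 * ((4 : ℕ) : ℝ) ^ 3 * ((2 * M + 2 + 1 : ℕ) : ℝ) * (2 * η))
        ≤ 4 * (128 * ((4 : ℕ) : ℝ) ^ 3 * (4 * M) * (2 * η)) := by gcongr
      _ = 262144 * (M : ℝ) * η := by push_cast; ring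

/-! ## §2 The corner-segment datum from equal top averages -/

/-- **THE CORNER-SEGMENT DATUM**: two unitary configurations with `SmallField · η`, the SAME `(k+1)`-fold average (`L = 2`, `M = 2^{k+1}`) and `10¹²·M²η ≤ 1` have
corner-segment transporters within `S = 20480·M²η`: `‖U′(M•ξ; [·, · + Me_i]) − U_s(M•ξ; [·, · + Me_i])‖ ≤ 20480·M²η`. [folklore] -/
theorem corner_segment_datum {U' Us : Site 4 → Fin 4 → (Matrix n n ℂ)ˣ} (hU' : IsUnitaryCfg U') (hUs : IsUnitaryCfg Us) {k : ℕ} {η : ℝ} (hη : 0 ≤ η)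
    (hS' : SmallField U' η) (hSs : SmallField Us η) (htop : cavgIter 2 (k + 1) U' = cavgIter 2 (k + 1) Us)
    (hθ : 1000000000000 * (((2 : ℝ) ^ (k + 1)) ^ 2 * η) ≤ 1) (ξ : Site 4) (i : Fin 4) :
    ‖((hol U' (((2 ^ (k + 1) : ℕ) : ℤ) • ξ) (seg i ((2 ^ (k + 1) : ℕ) : ℤ)) : (Matrix n n ℂ)ˣ) : Matrix n n ℂ)
        - ((hol Us (((2 ^ (k + 1) : ℕ) : ℤ) • ξ) (seg i ((2 ^ (k + 1) : ℕ) : ℤ)) : (Matrix n n ℂ)ˣ) : Matrix n n ℂ)‖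
      ≤ 20480 * (((2 : ℝ) ^ (k + 1)) ^ 2 * η) := by
  -- the multi-level class from the line
  have hk : ((2 : ℕ) : ℝ) ^ 2 * ((((2 : ℕ) : ℝ) ^ 2) ^ k * η) = ((2 : ℝ) ^ (k + 1)) ^ 2 * η := by
    push_cast
    rw [← pow_mul]
    ring
  have hs : LevelSmall 4 2 k η := by
    refine levelSmall_of_small (d := 4) (le_refl 2) k hη ?_ ?_
    · calc 14464 * (((4 : ℕ) : ℝ) + 1) ^ 2 * (((4 : ℕ) : ℝ) + 4) ^ 2 * ((2 : ℕ) : ℝ) ^ 2 * (8 / 3 * ((((2 : ℕ) : ℝ) ^ 2) ^ k * η))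
          = 14464 * (((4 : ℕ) : ℝ) + 1) ^ 2 * (((4 : ℕ) : ℝ) + 4) ^ 2 * (8 / 3) * (((2 : ℕ) : ℝ) ^ 2 * ((((2 : ℕ) : ℝ) ^ 2) ^ k * η)) := by ring
        _ = 14464 * (((4 : ℕ) : ℝ) + 1) ^ 2 * (((4 : ℕ) : ℝ) + 4) ^ 2 * (8 / 3) * (((2 : ℝ) ^ (k + 1)) ^ 2 * η) := by rw [hk]
        _ ≤ 1 / 2 := by push_cast; nlinarith
    · have hk' : ((((2 : ℕ) : ℝ) ^ 2) ^ k * η) ≤ ((2 : ℝ) ^ (k + 1)) ^ 2 * η := by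
        rw [← hk]; push_cast; nlinarith [pow_nonneg (by norm_num : (0 : ℝ) ≤ 2 ^ 2) k]
      simp only [twoLevelSmall]; push_cast at hk' ⊢; nlinarith
  have hA₁ : 14464 * (((3 + 1 : ℕ) : ℝ) + 1) ^ 2 * (((3 + 1 : ℕ) : ℝ) + 4) ^ 2 * (8 / 3) * ((((2 : ℕ) : ℝ) ^ (k + 1)) ^ 2 * η) ≤ 1 / 2 := by
    push_cast; nlinarith
  have hsum := segSum_le (d := 3) (le_refl 2) (le_refl k) hη hA₁
  have hsum' : ∑ m ∈ Finset.range (k + 1), ((2 : ℕ) : ℝ) ^ (k - m) * (4 * loopRad 4 2 (radIter 4 2 m η)) ≤ 10240 * (((2 : ℝ) ^ (k + 1)) ^ 2 * η) := by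
    have e4 : 256 * ((((3 + 1 : ℕ) : ℝ) + 1) * (((3 + 1 : ℕ) : ℝ) + 4)) * (((2 : ℕ) : ℝ) ^ (k + 1)) ^ 2 * η = 10240 * (((2 : ℝ) ^ (k + 1)) ^ 2 * η) := by
      push_cast; ring
    rw [← e4]; exact hsum
  have h1 := norm_cavgIter_sub_seg_le_top (le_refl 1 |>.trans one_le_two) k hU' hη hs hS' ξ i
  have h2 := norm_cavgIter_sub_seg_le_top (le_refl 1 |>.trans one_le_two) k hUs hη hs hSs ξ i
  have hC : (cavgIter 2 (k + 1) U' ξ i : (Matrix n n ℂ)ˣ) = cavgIter 2 (k + 1) Us ξ i := by rw [htop]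
  set A : Matrix n n ℂ := ((hol U' (((2 ^ (k + 1) : ℕ) : ℤ) • ξ) (seg i ((2 ^ (k + 1) : ℕ) : ℤ)) : (Matrix n n ℂ)ˣ) : Matrix n n ℂ) with hA
  set B : Matrix n n ℂ := ((hol Us (((2 ^ (k + 1) : ℕ) : ℤ) • ξ) (seg i ((2 ^ (k + 1) : ℕ) : ℤ)) : (Matrix n n ℂ)ˣ) : Matrix n n ℂ) with hB
  set C : Matrix n n ℂ := ((cavgIter 2 (k + 1) U' ξ i : (Matrix n n ℂ)ˣ) : Matrix n n ℂ) with hCdef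
  have hC' : ((cavgIter 2 (k + 1) Us ξ i : (Matrix n n ℂ)ˣ) : Matrix n n ℂ) = C := by rw [hCdef, hC]
  rw [hC'] at h2
  calc ‖A - B‖ = ‖(A - C) + (C - B)‖ := by rw [sub_add_sub_cancel]
    _ ≤ ‖A - C‖ + ‖C - B‖ := norm_add_le _ _
    _ ≤ 10240 * (((2 : ℝ) ^ (k + 1)) ^ 2 * η) + 10240 * (((2 : ℝ) ^ (k + 1)) ^ 2 * η) := by
        refine add_le_add (h1.trans hsum') ?_
        rw [norm_sub_rev]; exact h2.trans hsum'
    _ = _ := by ring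

/-! ## §3 The chart data bundle -/

/-- **THE PAIR CHART DATA** (see the file header): the pinned `N`-equivariant family on the radius-`M` cubes with cube letter `262144·Mη` and site-closeness
`4358144·M²η`, for unitary `(N·M)`-periodic `U′`, `U_s` with `SmallField · η`, equal `(k+1)`-fold averages and `10¹²·card n·M²η ≤ 1` (`M = 2^{k+1}`). [folklore] -/
theorem exists_pair_chart_data {U' Us : Site 4 → Fin 4 → (Matrix n n ℂ)ˣ} (hU' : IsUnitaryCfg U') (hUs : IsUnitaryCfg Us) {k N : ℕ}
    (hU'P : IsPeriodicCfg U' ((N * 2 ^ (k + 1) : ℕ) : ℤ)) (hUsP : IsPeriodicCfg Us ((N * 2 ^ (k + 1) : ℕ) : ℤ)) {η : ℝ} (hη : 0 < η)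
    (hS' : SmallField U' η) (hSs : SmallField Us η) (htop : cavgIter 2 (k + 1) U' = cavgIter 2 (k + 1) Us)
    (hθ : 1000000000000 * (Fintype.card n : ℝ) * (((2 : ℝ) ^ (k + 1)) ^ 2 * η) ≤ 1) :
    ∃ g : Site 4 → Site 4 → (Matrix n n ℂ)ˣ,
      (∀ ζ x, g ζ x ∈ unitaryUnits (Matrix n n ℂ)) ∧
      (∀ ζ, g ζ (((2 ^ (k + 1) : ℕ) : ℤ) • ζ) = 1) ∧
      (∀ (ζ x : Site 4) (κ : Fin 4), (∀ i, |x i - ((2 ^ (k + 1) : ℕ) : ℤ) * ζ i| ≤ ((2 ^ (k + 1) : ℕ) : ℤ)) →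
        ‖(((Us x κ)⁻¹ * gaugeAct (g ζ) U' x κ : (Matrix n n ℂ)ˣ) : Matrix n n ℂ) - 1‖ ≤ 262144 * ((2 : ℝ) ^ (k + 1)) * η) ∧
      (∀ (ζ x : Site 4) (i : Fin 4), g (ζ + (N : ℤ) • e i) (x + ((N * 2 ^ (k + 1) : ℕ) : ℤ) • e i) = g ζ x) ∧
      (∀ (ζ ζ' x : Site 4), (∀ i, |x i - ((2 ^ (k + 1) : ℕ) : ℤ) * ζ i| ≤ ((2 ^ (k + 1) : ℕ) : ℤ)) →
        (∀ i, |x i - ((2 ^ (k + 1) : ℕ) : ℤ) * ζ' i| ≤ ((2 ^ (k + 1) : ℕ) : ℤ)) →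
        ‖((g ζ x : (Matrix n n ℂ)ˣ) : Matrix n n ℂ) - ((g ζ' x : (Matrix n n ℂ)ˣ) : Matrix n n ℂ)‖ ≤ 4358144 * (((2 : ℝ) ^ (k + 1)) ^ 2 * η)) := by
  letI : CStarAlgebra (Matrix n n ℂ) := {}
  set M : ℕ := 2 ^ (k + 1) with hMdef
  have hM2 : 2 ≤ M := by
    rw [hMdef]
    calc 2 = 2 ^ 1 := by norm_num
      _ ≤ 2 ^ (k + 1) := Nat.pow_le_pow_right (by norm_num) (by omega)
  have hM1 : 1 ≤ M := le_trans (by norm_num) hM2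
  have hMr : (M : ℝ) = (2 : ℝ) ^ (k + 1) := by rw [hMdef]; push_cast; ring
  have hcard : (1 : ℝ) ≤ Fintype.card n := by exact_mod_cast Fintype.card_pos
  have hθ' : 1000000000000 * (Fintype.card n : ℝ) * ((M : ℝ) ^ 2 * η) ≤ 1 := by rw [hMr]; exact hθ
  have hθ1 : 1000000000000 * ((M : ℝ) ^ 2 * η) ≤ 1 := by
    have : (M : ℝ) ^ 2 * η ≤ (Fintype.card n : ℝ) * ((M : ℝ) ^ 2 * η) := le_mul_of_one_le_left (by positivity) hcard
    nlinarith
  obtain ⟨hε', hR1, hR2, hηch⟩ := chart_regime hM2 hη hcard hθ'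
  obtain ⟨g, hgU, hpin, herr, hgeq⟩ := exists_pair_chart_family hU' hUs hU'P hUsP hη hS' hSs hε' hR1 hR2
  have herr' : ∀ (ζ x : Site 4) (κ : Fin 4), (∀ i, |x i - (M : ℤ) * ζ i| ≤ (M : ℤ)) →
      ‖(((Us x κ)⁻¹ * gaugeAct (g ζ) U' x κ : (Matrix n n ℂ)ˣ) : Matrix n n ℂ) - 1‖ ≤ 262144 * (M : ℝ) * η :=
    fun ζ x κ hx => (herr ζ x κ hx).trans hηch
  -- the corner-segment datum and F318's site-closeness
  have hS : ∀ (ξ : Site 4) (i : Fin 4), ‖((hol U' ((M : ℤ) • ξ) (seg i (M : ℤ)) : (Matrix n n ℂ)ˣ) : Matrix n n ℂ)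
      - ((hol Us ((M : ℤ) • ξ) (seg i (M : ℤ)) : (Matrix n n ℂ)ˣ) : Matrix n n ℂ)‖ ≤ 20480 * ((M : ℝ) ^ 2 * η) := by
    intro ξ i
    have h := corner_segment_datum hU' hUs hη.le hS' hSs htop (by rw [← hMr]; exact hθ1) ξ i
    rw [hMr]; rw [hMdef]; exact h
  have hclose : ∀ (ζ ζ' x : Site 4), (∀ i, |x i - (M : ℤ) * ζ i| ≤ (M : ℤ)) → (∀ i, |x i - (M : ℤ) * ζ' i| ≤ (M : ℤ)) →
      ‖((g ζ x : (Matrix n n ℂ)ˣ) : Matrix n n ℂ) - ((g ζ' x : (Matrix n n ℂ)ˣ) : Matrix n n ℂ)‖ ≤ 4358144 * ((M : ℝ) ^ 2 * η) := by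
    intro ζ ζ' x hx hx'
    have h := norm_chart_sub_chart_le (d := 4) hUs hU' hgU hM1 hpin (by positivity : (0 : ℝ) ≤ 262144 * (M : ℝ) * η)
      (by positivity : (0 : ℝ) ≤ 20480 * ((M : ℝ) ^ 2 * η)) herr' hS hx hx'
    have : 2 * (((4 : ℕ) : ℝ) * ((M : ℝ) * (262144 * (M : ℝ) * η) + 20480 * ((M : ℝ) ^ 2 * η))) + 2 * ((4 : ℕ) : ℝ) * (M : ℝ) * (262144 * (M : ℝ) * η)
        = 4358144 * ((M : ℝ) ^ 2 * η) := by push_cast; ring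
    rw [this] at h; exact h
  refine ⟨g, hgU, hpin, fun ζ x κ hx => ?_, hgeq, fun ζ ζ' x hx hx' => ?_⟩
  · have h := herr' ζ x κ hx; rw [hMr] at h; exact h
  · have h := hclose ζ ζ' x hx hx'; rw [hMr] at h; exact h

end

end Summit.QuantumFields.BalabanUV.T4Continuum.NE7PairChartData
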